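import Literature.Probability.LatticeModels.RCExterior
import HarnessLib

/-!
# Random-cluster contours, IV: intrinsic consistency of contours; the abstract contour setup

Topic `Literature/Probability/LatticeModels`. For a contour `γ = (γ̄, open edges, ordB)` extracted from
a configuration (and hence for every well-formed contour) the *intrinsic* configuration `γ.IsOpen`
("ω_γ̄ extended by the labels", FV §7.2.6) agrees with the configuration on the ball of every site of
`γ̄ ∪ ∂^ex γ̄`; consequently the intrinsic good/bad status of these sites is the recorded one: the sites
of `∂^ex γ̄` are good, `ord`-good exactly on `ordB`, the type is read off the exterior part of `∂^ex γ̄`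
and the labels off the interior boundaries (`WF.consistency`). We then package the well-formed
contours as an abstract `ContourSetup` (`rcSetup d`, with at most `(4^{3^d})^{|γ̄|}` contours of given
support) and define the **external contours of a configuration** of a volume, proving that they form
an external family of the type of the boundary condition and that their hulls lie in the inner volume.

Everything is proved; no named facts.

## References

* S. Friedli, Y. Velenik, *Statistical Mechanics of Lattice Systems*, CUP 2017, §7.2.6 (Def. 7.18,
  Lemma 7.19, the configuration ω_γ̄), §7.3 (Def. 7.21–7.22, Lemma 7.23, eq. (7.26)). [FriedliVelenik2017]
* G. Grimmett, *The Random-Cluster Model*, Springer 2006, §7.5. [Grimmett2006]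
-/

noncomputable section

open Finset Relation

namespace Literature.Probability.LatticeModels

namespace RCC

variable {d : ℕ}

/-! ### Intrinsic goodness for a contour -/

namespace Contour

/-- Intrinsic `ord`-goodness: all ball edges intrinsically open. [cite: FriedliVelenik2017, §7.2.6] -/
def IOrdGood (γ : Contour d) (x : Site d) : Prop := ∀ e ∈ ballEdges x, γ.IsOpen e

/-- Intrinsic `dis`-goodness: all ball edges intrinsically closed. [cite: FriedliVelenik2017, §7.2.6] -/
def IDisGood (γ : Contour d) (x : Site d) : Prop := ∀ e ∈ ballEdges x, ¬ γ.IsOpen e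

/-- Intrinsic badness. [cite: FriedliVelenik2017, §7.2.6] -/
def IBad (γ : Contour d) (x : Site d) : Prop := ¬ γ.IOrdGood x ∧ ¬ γ.IDisGood x

end Contour

/-! ### Agreement on the neighbourhood of the support -/

section Agreement

variable {σ : Phase} {F ω : Finset (Sym2 (Site d))} (hω : ω ⊆ F) {S : Finset (Site d)} (hS : S ∈ supports σ F ω)
include hω hS

/-- **Agreement on the ball of an exterior-boundary site**: for `y ∈ ∂^ex S` and `e` in the ball of `y`,
the intrinsic openness of the extracted contour is the openness in `ω`. [cite: FriedliVelenik2017, §7.2.6] -/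
theorem isOpen_iff_eOpen_of_mem_exBoundary (hd : 2 ≤ d) {y : Site d} (hy : y ∈ exBoundary S) {e : Sym2 (Site d)}
    (he : e ∈ ballEdges y) : (contourAt σ F ω S).IsOpen e ↔ EOpen σ F ω e := by
  obtain ⟨heE, hye⟩ := mem_ballEdges_iff.1 he
  obtain ⟨hyS, x, hx, hxy⟩ := mem_exBoundary.1 hy
  -- if `e` touches `S`, use the agreement on balls of support sites
  by_cases htouch : ∃ z ∈ e, z ∈ S
  · obtain ⟨z, hze, hzS⟩ := htouch
    refine isOpen_iff_eOpen_of_mem_supp hω hS hd hzS (mem_ballEdges_iff.2 ⟨heE, mem_coBall_of_mem heE hze⟩)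
  · push Not at htouch
    have hin : e ∉ nnEdges S := fun h => by
      induction e using Sym2.ind with
      | h a b => exact htouch a (Sym2.mem_mk_left a b) ((mk_mem_nnEdges.1 h).2.1)
    have hunb : ∀ z ∈ starBall y, ¬ Bad σ F ω z := fun z hz => not_bad_near_exBoundary hω hS hy hz
    have hval : EOpen σ F ω e ↔ OrdGood σ F ω y := by
      constructor
      · intro ho
        by_contra hno
        have hdis : DisGood σ F ω y := by by_contra hnd; exact hunb y (mem_starBall_self y) ⟨hno, hnd⟩
        exact hdis e he ho
      · intro hg; exact hg e he
    rw [hval, Contour.IsOpen, contourAt_supp]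
    constructor
    · rintro (h | ⟨-, u, hue, huS, hc⟩)
      · exact absurd (mem_filter.1 h).1 hin
      · -- `u ∈ starBall y`, `u ∉ S`: chained to `y` in one step (or equal)
        have huy : ReflTransGen (starRel (S : Set (Site d))ᶜ) u y := by
          by_cases h : u = y
          · rw [h]
          · exact ReflTransGen.single ⟨adj_iff_mem_starBall.2 ⟨mem_starBall_comm.1 (mem_coBall_iff.1 hye u hue), h⟩,
              fun h' => huS (mem_coe.1 h'), fun h' => hyS (mem_coe.1 h')⟩
        exact (compOrd_contourAt_iff hω hS hd hy huy).1 hc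
    · intro hg
      induction e using Sym2.ind with
      | h a b =>
        refine Or.inr ⟨hin, a, Sym2.mem_mk_left a b, htouch a (Sym2.mem_mk_left a b), ?_⟩
        have hay : ReflTransGen (starRel (S : Set (Site d))ᶜ) a y := by
          by_cases h : a = y
          · rw [h]
          · exact ReflTransGen.single ⟨adj_iff_mem_starBall.2 ⟨mem_starBall_comm.1 (mem_coBall_iff.1 hye a (Sym2.mem_mk_left a b)), h⟩,
              fun h' => htouch a (Sym2.mem_mk_left a b) (mem_coe.1 h'), fun h' => hyS (mem_coe.1 h')⟩
        exact (compOrd_contourAt_iff hω hS hd hy hay).2 hg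

/-- **Intrinsic and actual goodness agree on `S ∪ ∂^ex S`.** [cite: FriedliVelenik2017, §7.2.6] -/
theorem iOrdGood_iff (hd : 2 ≤ d) {z : Site d} (hz : z ∈ S ∨ z ∈ exBoundary S) :
    (contourAt σ F ω S).IOrdGood z ↔ OrdGood σ F ω z := by
  rcases hz with hz | hz
  · exact forall₂_congr fun e he => isOpen_iff_eOpen_of_mem_supp hω hS hd hz he
  · exact forall₂_congr fun e he => isOpen_iff_eOpen_of_mem_exBoundary hω hS hd hz he

/-- Intrinsic and actual `dis`-goodness agree on `S ∪ ∂^ex S`. [cite: FriedliVelenik2017, §7.2.6] -/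
theorem iDisGood_iff (hd : 2 ≤ d) {z : Site d} (hz : z ∈ S ∨ z ∈ exBoundary S) :
    (contourAt σ F ω S).IDisGood z ↔ DisGood σ F ω z := by
  rcases hz with hz | hz
  · exact forall₂_congr fun e he => not_congr (isOpen_iff_eOpen_of_mem_supp hω hS hd hz he)
  · exact forall₂_congr fun e he => not_congr (isOpen_iff_eOpen_of_mem_exBoundary hω hS hd hz he)

/-- Intrinsic and actual badness agree on `S ∪ ∂^ex S`. [cite: FriedliVelenik2017, §7.2.6] -/
theorem iBad_iff (hd : 2 ≤ d) {z : Site d} (hz : z ∈ S ∨ z ∈ exBoundary S) :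
    (contourAt σ F ω S).IBad z ↔ Bad σ F ω z := by
  rw [Contour.IBad, Bad, iOrdGood_iff hω hS hd hz, iDisGood_iff hω hS hd hz]

/-- The type of the extracted contour is read off any exterior-boundary site in the exterior.
[cite: FriedliVelenik2017, §7.2.6 (type = label of ext)] -/
theorem type_contourAt_eq_ord_iff (hd : 2 ≤ d) {y : Site d} (hy : y ∈ exBoundary S) (hye : y ∈ starExt S) :
    (contourAt σ F ω S).type = Phase.ord ↔ OrdGood σ F ω y := by
  classical
  rw [Contour.type]
  simp only [contourAt_supp]
  rw [ite_eq_left_iff]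
  constructor
  · intro h
    by_contra hno
    have : ¬ ∃ y' ∈ (contourAt σ F ω S).ordB, y' ∈ starExt S := by
      rintro ⟨y', hy', hy'e⟩
      obtain ⟨hy'b, hy'g⟩ := mem_filter.1 hy'
      -- `y, y'` both exterior: chained in `ext S ⊆ Sᶜ`
      have hchain := reflTransGen_starRel_mono (show starExt S ⊆ (↑S : Set (Site d))ᶜ from fun z hz hzS => hz.1 (mem_coe.1 hzS))
        (starConn_starExt hd S y hye y' hy'e)
      exact hno ((ordGood_iff_of_reflTransGen hω hS hd hy hy'b hchain).2 hy'g)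
    exact absurd (h this) (by decide)
  · intro hg hno
    exact absurd ⟨y, mem_filter.2 ⟨hy, hg⟩, hye⟩ hno

/-- The label of an interior component is read off any of its interior-boundary sites.
[cite: FriedliVelenik2017, §7.2.6, Lemma 7.19] -/
theorem lab_contourAt_eq_ord_iff (hd : 2 ≤ d) {u : Site d} (hu : u ∈ starInt S) {y : Site d} (hy : y ∈ inBoundary (starIntComp S u)) :
    (contourAt σ F ω S).lab (starIntComp S u) = Phase.ord ↔ OrdGood σ F ω y := by
  classical
  have hSconn := (support_props hS).2.2.1
  have hAmax : ∀ x ∈ starIntComp S u, ∀ z, z ∉ S → (zdStar d).Adj x z → z ∈ starIntComp S u := fun x hx z hz hxz =>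
    mem_starIntComp_of_starRel hd hu hx ⟨hxz, fun h' => ((mem_starInt hd).1 (starIntComp_subset S u hx)).1 (mem_coe.1 h'),
      fun h' => hz (mem_coe.1 h')⟩
  have hAS : Disjoint (starIntComp S u) S :=
    Finset.disjoint_left.2 fun x hx hxS => ((mem_starInt hd).1 (starIntComp_subset S u hx)).1 hxS
  have hyb : y ∈ exBoundary S := inBoundary_subset_exBoundary_of_compl hAmax hAS hy
  have hyA : y ∈ starIntComp S u := (mem_inBoundary.1 hy).1
  rw [Contour.lab]
  rw [ite_eq_left_iff]
  constructor
  · intro h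
    by_contra hno
    refine absurd (h ?_) (by decide)
    rintro ⟨y', hy', hy'A⟩
    obtain ⟨hy'b, hy'g⟩ := mem_filter.1 hy'
    have hchain : ReflTransGen (starRel (S : Set (Site d))ᶜ) y y' :=
      ((mem_starIntComp hd hu).1 hyA |> reflTransGen_starRel_symm).trans ((mem_starIntComp hd hu).1 hy'A)
    exact hno ((ordGood_iff_of_reflTransGen hω hS hd hyb hy'b hchain).2 hy'g)
  · intro hg hno
    exact absurd ⟨y, mem_filter.2 ⟨hyb, hg⟩, hyA⟩ hno

end Agreement

/-! ### Consistency of well-formed contours -/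

/-- **The consistency package of a well-formed contour** (everything intrinsic):
(1) the support is the thickening of its intrinsically bad sites; (2) exterior-boundary sites are not
intrinsically bad, and are intrinsically `ord`-good iff in `ordB`, `dis`-good iff not; (3) on the exterior
part of the boundary, `ordB` is all or nothing according to the type; (4) on the interior boundary of a
component, according to its label; (5) `openE ⊆` edges of the support, `ordB ⊆ ∂^ex` of the support.
[cite: FriedliVelenik2017, §7.2.6, Def. 7.18 and Lemma 7.19] -/
theorem WF.consistency (hd : 2 ≤ d) {γ : Contour d} (h : WF γ) :
    (∀ y, y ∈ γ.supp ↔ ∃ b ∈ γ.supp, γ.IBad b ∧ y ∈ starBall b) ∧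
    (∀ y ∈ exBoundary γ.supp, ¬ γ.IBad y ∧ (γ.IOrdGood y ↔ y ∈ γ.ordB) ∧ (γ.IDisGood y ↔ y ∉ γ.ordB)) ∧
    (∀ y ∈ exBoundary γ.supp, y ∈ starExt γ.supp → (y ∈ γ.ordB ↔ γ.type = Phase.ord)) ∧
    (∀ u ∈ starInt γ.supp, ∀ y ∈ inBoundary (starIntComp γ.supp u), (y ∈ γ.ordB ↔ γ.lab (starIntComp γ.supp u) = Phase.ord)) ∧
    γ.openE ⊆ nnEdges γ.supp ∧ γ.ordB ⊆ exBoundary γ.supp := by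
  have hd1 : 1 ≤ d := by omega
  obtain ⟨σ, F, ω, hω, hγ⟩ := h
  obtain ⟨S, hS, rfl⟩ := mem_contoursOf.1 hγ
  have hnb : ∀ y ∈ exBoundary S, ¬ Bad σ F ω y := fun y hy => not_bad_near_exBoundary hω hS hy (mem_starBall_self y)
  refine ⟨fun y => ?_, fun y hy => ⟨?_, ?_, ?_⟩, fun y hy hye => ?_, fun u hu y hy => ?_, filter_subset _ _, filter_subset _ _⟩
  · rw [contourAt_supp, mem_support_iff_exists_bad hω hS]
    exact exists_congr fun b => and_congr_right fun hb => by rw [iBad_iff hω hS hd (Or.inl hb)]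
  · rw [iBad_iff hω hS hd (Or.inr hy)]; exact hnb y hy
  · rw [iOrdGood_iff hω hS hd (Or.inr hy)]
    exact ⟨fun hg => mem_filter.2 ⟨hy, hg⟩, fun h => (mem_filter.1 h).2⟩
  · rw [iDisGood_iff hω hS hd (Or.inr hy)]
    constructor
    · intro hdg h; exact not_ordGood_of_disGood hd1 hdg (mem_filter.1 h).2
    · intro h
      by_contra hnd
      have hno : ¬ OrdGood σ F ω y := fun hg => h (mem_filter.2 ⟨hy, hg⟩)
      exact hnb y hy ⟨hno, hnd⟩
  · rw [type_contourAt_eq_ord_iff hω hS hd hy hye]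
    exact ⟨fun h => (mem_filter.1 h).2, fun hg => mem_filter.2 ⟨hy, hg⟩⟩
  · simp only [contourAt_supp] at hu hy ⊢
    rw [lab_contourAt_eq_ord_iff hω hS hd hu hy]
    have hAmax : ∀ x ∈ starIntComp S u, ∀ z, z ∉ S → (zdStar d).Adj x z → z ∈ starIntComp S u := fun x hx z hz hxz =>
      mem_starIntComp_of_starRel hd hu hx ⟨hxz, fun h' => ((mem_starInt hd).1 (starIntComp_subset S u hx)).1 (mem_coe.1 h'),
        fun h' => hz (mem_coe.1 h')⟩
    have hAS : Disjoint (starIntComp S u) S :=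
      Finset.disjoint_left.2 fun x hx hxS => ((mem_starInt hd).1 (starIntComp_subset S u hx)).1 hxS
    have hyb : y ∈ exBoundary S := inBoundary_subset_exBoundary_of_compl hAmax hAS hy
    exact ⟨fun h => (mem_filter.1 h).2, fun hg => mem_filter.2 ⟨hyb, hg⟩⟩

/-! ### The abstract contour setup of well-formed contours -/

/-- The candidate contours with support `S`. [folklore] -/
def candidates (S : Finset (Site d)) : Finset (Contour d) :=
  ((nnEdges S).powerset ×ˢ (exBoundary S).powerset).image fun p => ⟨S, p.1, p.2⟩

/-- Membership in `candidates`. [folklore] -/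
theorem mem_candidates {S : Finset (Site d)} {γ : Contour d} :
    γ ∈ candidates S ↔ γ.supp = S ∧ γ.openE ⊆ nnEdges S ∧ γ.ordB ⊆ exBoundary S := by
  rw [candidates, mem_image]
  constructor
  · rintro ⟨p, hp, rfl⟩
    obtain ⟨h1, h2⟩ := mem_product.1 hp
    exact ⟨rfl, mem_powerset.1 h1, mem_powerset.1 h2⟩
  · rintro ⟨rfl, h1, h2⟩
    exact ⟨(γ.openE, γ.ordB), mem_product.2 ⟨mem_powerset.2 h1, mem_powerset.2 h2⟩, rfl⟩

/-- `|∂^ex S| ≤ 3^d |S|`. [folklore] -/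
theorem card_exBoundary_le (S : Finset (Site d)) : #(exBoundary S) ≤ 3 ^ d * #S := by
  rw [exBoundary]
  refine (card_le_card sdiff_subset).trans (card_biUnion_le.trans ?_)
  rw [mul_comm, ← smul_eq_mul, ← sum_const]
  exact sum_le_sum fun x _ => (card_starBall x).le

/-- `|candidates S| ≤ (4^{3^d})^{|S|}`. [folklore] -/
theorem card_candidates_le (S : Finset (Site d)) : #(candidates S) ≤ (4 ^ 3 ^ d) ^ #S := by
  refine card_image_le.trans ?_
  rw [card_product, card_powerset, card_powerset]
  calc 2 ^ #(nnEdges S) * 2 ^ #(exBoundary S) ≤ 2 ^ (3 ^ d * #S) * 2 ^ (3 ^ d * #S) :=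
        Nat.mul_le_mul (Nat.pow_le_pow_right (by norm_num) (card_nnEdges_le S))
          (Nat.pow_le_pow_right (by norm_num) (card_exBoundary_le S))
    _ = (4 ^ 3 ^ d) ^ #S := by rw [← pow_add, ← two_mul, show (4 : ℕ) = 2 ^ 2 by norm_num, ← pow_mul, ← pow_mul]

variable (d) in
/-- **The contour setup of the random-cluster model**: the well-formed contours with their support,
type and labels. [cite: FriedliVelenik2017, §7.2.6 (𝒞^#); Grimmett2006, §7.5] -/
def rcSetup : ContourSetup d where
  Γ := {γ : Contour d // WF γ}
  supp := fun γ => γ.1.supp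
  type := fun γ => γ.1.type
  lab := fun γ A => γ.1.lab A
  withSupp := fun S => by classical exact (candidates S).subtype WF
  mem_withSupp := fun S γ => by
    classical
    rw [Finset.mem_subtype, mem_candidates]
    constructor
    · intro h; exact h.1
    · intro h
      by_cases hd : 2 ≤ d
      · obtain ⟨-, -, -, -, h1, h2⟩ := WF.consistency hd γ.2
        exact ⟨h, h ▸ h1, h ▸ h2⟩
      · -- in dimension `< 2` we read the inclusions off a realization directly
        obtain ⟨σ, F, ω, -, hγ⟩ := γ.2
        obtain ⟨S', -, hS'⟩ := mem_contoursOf.1 hγ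
        have hsupp : S' = γ.1.supp := by rw [← hS']; rfl
        refine ⟨h, ?_, ?_⟩
        · rw [← h, ← hsupp, ← hS']; exact filter_subset _ _
        · rw [← h, ← hsupp, ← hS']; exact filter_subset _ _
  supp_nonempty := fun γ => (WF.supp_nonempty_starConn γ.2).1
  supp_starConn := fun γ => (WF.supp_nonempty_starConn γ.2).2

/-- **At most `(4^{3^d})^{|S|}` well-formed contours have support `S`.** [cite: FriedliVelenik2017, §7.3 (counting contours)] -/
theorem card_withSupp_rcSetup_le (S : Finset (Site d)) : #((rcSetup d).withSupp S) ≤ (4 ^ 3 ^ d) ^ #S := by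
  classical
  change #((candidates S).subtype WF) ≤ _
  rw [card_subtype]
  exact (card_le_card (filter_subset _ _)).trans (card_candidates_le S)

/-! ### The external contours of a configuration -/

section External

open ContourSetup

variable {σ : Phase} {F ω : Finset (Sym2 (Site d))}

/-- The extracted contour at a support, as a well-formed contour. [folklore] -/
def wfContourAt (hω : ω ⊆ F) (S : Finset (Site d)) (hS : S ∈ supports σ F ω) : (rcSetup d).Γ :=
  ⟨contourAt σ F ω S, σ, F, ω, hω, mem_contoursOf.2 ⟨S, hS, rfl⟩⟩

variable (σ) in
/-- **The external contours of a configuration**: the contours at the hull-maximal supports.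
[cite: FriedliVelenik2017, §7.3, Def. 7.22] -/
def extContours (hω : ω ⊆ F) : Finset (rcSetup d).Γ :=
  (maxSupports σ F ω).attach.image fun T =>
    wfContourAt hω T.1.1 (mem_rawSupports.1 (maxP_subset (S := rawSetup d) _ T.2))

/-- Membership in `extContours`. [folklore] -/
theorem mem_extContours {hω : ω ⊆ F} {γ : (rcSetup d).Γ} :
    γ ∈ extContours σ hω ↔ ∃ T ∈ maxSupports σ F ω, γ.1 = contourAt σ F ω T.1 := by
  rw [extContours, mem_image]
  constructor
  · rintro ⟨T, -, hT⟩; exact ⟨T.1, T.2, by rw [← hT]; rfl⟩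
  · rintro ⟨T, hT, hγ⟩
    exact ⟨⟨T, hT⟩, mem_attach _ _, Subtype.ext hγ.symm⟩

/-- The support of an external contour is a hull-maximal support. [folklore] -/
theorem supp_mem_of_mem_extContours {hω : ω ⊆ F} {γ : (rcSetup d).Γ} (h : γ ∈ extContours σ hω) :
    γ.1.supp ∈ supports σ F ω ∧ ∃ T ∈ maxSupports σ F ω, T.1 = γ.1.supp := by
  obtain ⟨T, hT, hγ⟩ := mem_extContours.1 h
  have : γ.1.supp = T.1 := by rw [hγ]; rfl
  exact ⟨this ▸ mem_rawSupports.1 (maxP_subset (S := rawSetup d) _ hT), T, hT, this.symm⟩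

/-- External contours are pairwise compatible. [cite: FriedliVelenik2017, §7.3] -/
theorem pairwise_compat_extContours (hω : ω ⊆ F) :
    ((extContours σ hω : Finset (rcSetup d).Γ) : Set (rcSetup d).Γ).Pairwise (rcSetup d).Compat := by
  intro γ hγ γ' hγ' hne x hx y hy
  obtain ⟨hs, -⟩ := supp_mem_of_mem_extContours (mem_coe.1 hγ)
  obtain ⟨hs', -⟩ := supp_mem_of_mem_extContours (mem_coe.1 hγ')
  refine supDist_gt_one_of_ne hs hs' (fun h => hne (Subtype.ext ?_)) hx hy
  obtain ⟨T, -, hT⟩ := mem_extContours.1 (mem_coe.1 hγ)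
  obtain ⟨T', -, hT'⟩ := mem_extContours.1 (mem_coe.1 hγ')
  rw [hT, hT']
  have h1 : T.1 = γ.1.supp := by rw [hT]; rfl
  have h2 : T'.1 = γ'.1.supp := by rw [hT']; rfl
  rw [h1, h2, h]

/-- External contours have pairwise disjoint hulls. [cite: FriedliVelenik2017, §7.3, Def. 7.22] -/
theorem pairwise_disjoint_hull_extContours (hd : 2 ≤ d) (hω : ω ⊆ F) :
    ((extContours σ hω : Finset (rcSetup d).Γ) : Set (rcSetup d).Γ).Pairwise fun γ γ' =>
      Disjoint ((rcSetup d).hull γ) ((rcSetup d).hull γ') := by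
  intro γ hγ γ' hγ' hne
  obtain ⟨-, T, hT, hTs⟩ := supp_mem_of_mem_extContours (mem_coe.1 hγ)
  obtain ⟨-, T', hT', hT's⟩ := supp_mem_of_mem_extContours (mem_coe.1 hγ')
  have hTT' : T ≠ T' := by
    intro h
    apply hne
    obtain ⟨T₁, -, h₁⟩ := mem_extContours.1 (mem_coe.1 hγ)
    obtain ⟨T₂, -, h₂⟩ := mem_extContours.1 (mem_coe.1 hγ')
    have e1 : T₁.1 = γ.1.supp := by rw [h₁]; rfl
    have e2 : T₂.1 = γ'.1.supp := by rw [h₂]; rfl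
    have hs : γ.1.supp = γ'.1.supp := by rw [← hTs, ← hT's, h]
    apply Subtype.ext
    rw [h₁, h₂, e1, e2, hs]
  have := pairwise_disjoint_hull_maxP (S := rawSetup d) (P := fun _ => True) hd pairwise_compat_rawSupports
    (mem_coe.2 hT) (mem_coe.2 hT') hTT'
  change Disjoint (starHullFinset γ.1.supp) (starHullFinset γ'.1.supp)
  rw [← hTs, ← hT's]; exact this

/-- **The exterior boundary `∂^ex(hull γ̄)` of an external contour lies in the exterior of all contours.**
[cite: FriedliVelenik2017, §7.3, proof of Lemma 7.23] -/
theorem exBoundary_hull_subset_exteriorAll (hd : 2 ≤ d) {hω : ω ⊆ F} {γ : (rcSetup d).Γ} (h : γ ∈ extContours σ hω) :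
    (exBoundary (starHullFinset γ.1.supp) : Set (Site d)) ⊆ exteriorAll σ F ω := by
  classical
  obtain ⟨-, T, hT, hTs⟩ := supp_mem_of_mem_extContours h
  rw [exteriorAll_eq_commonExt hd, ← hTs]
  exact exBoundary_hull_subset_commonExt hd ((pairwise_compat_rawSupports).mono (coe_subset.2 (maxP_subset (S := rawSetup d) _)))
    (pairwise_disjoint_hull_maxP (S := rawSetup d) hd pairwise_compat_rawSupports) hT

/-- An exterior-boundary site of the hull is an exterior-boundary site of the support lying in the
exterior. [folklore] -/
theorem mem_exBoundary_of_mem_exBoundary_hull (hd : 2 ≤ d) {S : Finset (Site d)} {y : Site d} (hy : y ∈ exBoundary (starHullFinset S)) :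
    y ∈ exBoundary S ∧ y ∈ starExt S := by
  obtain ⟨hyh, x, hx, hxy⟩ := mem_exBoundary.1 hy
  have hye : y ∈ starExt S := by by_contra h; exact hyh ((mem_starHullFinset hd).2 h)
  have hyS : y ∉ S := fun h => hyh ((mem_starHullFinset hd).2 (subset_starHull S (mem_coe.2 h)))
  have hxS : x ∈ S := by
    by_contra hxS
    have hxi : x ∈ starInt S := (mem_starInt hd).2 ⟨hxS, (mem_starHullFinset hd).1 hx⟩
    exact ((mem_starInt hd).1 (mem_starInt_of_reflTransGen hd hxi (ReflTransGen.single
      ⟨hxy, fun h' => hxS (mem_coe.1 h'), fun h' => hyS (mem_coe.1 h')⟩))).2 hye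
  exact ⟨mem_exBoundary.2 ⟨hyS, x, hxS, hxy⟩, hye⟩

/-- The exterior boundary of a non-empty finite set is non-empty (`d ≥ 1`). [folklore] -/
theorem exBoundary_nonempty (hd : 1 ≤ d) {T : Finset (Site d)} (hT : T.Nonempty) : (exBoundary T).Nonempty := by
  set i : Fin d := ⟨0, hd⟩
  obtain ⟨x, hx, hmax⟩ := exists_max_image T (fun z => z i) hT
  refine ⟨Function.update x i (x i + 1), mem_exBoundary.2 ⟨fun h => ?_, x, hx, adj_update_succ x i (x i) |> fun h' => by
    rwa [Function.update_eq_self] at h'⟩⟩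
  have := hmax _ h
  simp at this

/-- **External contours of an `ord`/`dis`-volume configuration have the type of the boundary condition.**
[cite: FriedliVelenik2017, §7.3, Lemma 7.23 (external contours are of type #)] -/
theorem type_eq_of_mem_extContours (hd : 2 ≤ d) {V : Finset (Site d)} {ω : Finset (Sym2 (Site d))} {hω : ω ⊆ freeEdges V}
    {γ : (rcSetup d).Γ} (h : γ ∈ extContours σ hω) : (rcSetup d).type γ = σ := by
  have hd1 : 1 ≤ d := by omega
  obtain ⟨hs, -⟩ := supp_mem_of_mem_extContours h
  obtain ⟨T, -, hγT⟩ := mem_extContours.1 h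
  have hTs : T.1 = γ.1.supp := by rw [hγT]; rfl
  obtain ⟨y, hy⟩ := exBoundary_nonempty hd1 (T := starHullFinset γ.1.supp)
    ⟨_, (mem_starHullFinset hd).2 (subset_starHull _ (mem_coe.2 (support_props hs).2.1.choose_spec))⟩
  obtain ⟨hyb, hye⟩ := mem_exBoundary_of_mem_exBoundary_hull hd hy
  have hygood : Good σ (freeEdges V) ω σ y := good_of_mem_exteriorAll hd hω (exBoundary_hull_subset_exteriorAll hd h (mem_coe.2 hy))
  have key : γ.1.type = Phase.ord ↔ OrdGood σ (freeEdges V) ω y := by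
    rw [hγT]; rw [← hTs] at hyb hye; exact type_contourAt_eq_ord_iff hω (hTs ▸ hs) hd hyb hye
  change γ.1.type = σ
  cases σ with
  | ord => exact key.2 hygood
  | dis =>
    rcases Phase.eq_or_eq_other Phase.ord γ.1.type with h' | h'
    · exact absurd (key.1 h') (not_ordGood_of_disGood hd1 hygood)
    · exact h'

/-- External contours of a volume configuration keep their `★`-neighbourhood in the volume.
[cite: FriedliVelenik2017, §7.3 (Ω^#_Λ)] -/
theorem inVol_of_mem_extContours {V : Finset (Site d)} {ω : Finset (Sym2 (Site d))} {hω : ω ⊆ freeEdges V}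
    {γ : (rcSetup d).Γ} (h : γ ∈ extContours σ hω) : (rcSetup d).InVol γ V :=
  biUnion_starBall_subset_of_mem_supports hω (supp_mem_of_mem_extContours h).1

/-- **The external contours of a configuration of the volume `V` (with `★`-connected complement) form an
external family of type `σ` in `V`.** [cite: FriedliVelenik2017, §7.3, Def. 7.22 and Lemma 7.23] -/
theorem extContours_mem_extFam (hd : 2 ≤ d) {V : Finset (Site d)} {ω : Finset (Sym2 (Site d))} (hω : ω ⊆ freeEdges V) :
    extContours σ hω ∈ (rcSetup d).ExtFam σ V := by
  exact mem_extFam.2 ⟨mem_compFam.2 ⟨fun γ hγ => ⟨type_eq_of_mem_extContours hd hγ, inVol_of_mem_extContours hγ⟩,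
    pairwise_compat_extContours hω⟩, pairwise_disjoint_hull_extContours hd hω⟩

/-! ### Hulls lie in the inner volume -/

/-- A midpoint at `d_∞`-distance `≤ 1` from both ends of a pair at distance `≤ 2`. [folklore] -/
theorem exists_midpoint {u w : Site d} (h : supDist u w ≤ 2) : ∃ z, supDist u z ≤ 1 ∧ supDist z w ≤ 1 := by
  rw [supDist_le_iff] at h
  have key : ∀ j, ∃ m : ℤ, (u j - m).natAbs ≤ 1 ∧ (m - w j).natAbs ≤ 1 := by
    intro j
    have := h j
    by_cases h1 : w j ≤ u j - 1
    · exact ⟨u j - 1, by omega, by omega⟩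
    · by_cases h2 : u j + 1 ≤ w j
      · exact ⟨u j + 1, by omega, by omega⟩
      · exact ⟨w j, by omega, by omega⟩
  choose z hz using key
  exact ⟨z, supDist_le_iff.2 fun j => (hz j).1, supDist_le_iff.2 fun j => (hz j).2⟩

/-- **The interior of a support of a volume configuration lies in the core of the volume** (given that its
hull lies in the volume). [cite: FriedliVelenik2017, §7.3] -/
theorem starInt_subset_core (hd : 2 ≤ d) {S V : Finset (Site d)} (hS1 : S.biUnion starBall ⊆ V) (hS2 : starHullFinset S ⊆ V) :
    starInt S ⊆ core V := by
  intro u hu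
  refine mem_core.2 fun w hw => ?_
  obtain ⟨z, huz, hzw⟩ := exists_midpoint (mem_starBall2.1 hw)
  -- `z ∈ S ∪ int S`
  have hz : z ∈ S ∨ z ∈ starInt S := by
    by_cases hzS : z ∈ S
    · exact Or.inl hzS
    · by_cases hzu : u = z
      · exact Or.inr (hzu ▸ hu)
      · exact Or.inr (mem_starInt_of_reflTransGen hd hu (ReflTransGen.single ⟨zdStar_adj.2 ⟨hzu, huz⟩,
          fun h' => ((mem_starInt hd).1 hu).1 (mem_coe.1 h'), fun h' => hzS (mem_coe.1 h')⟩))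
  rcases hz with hzS | hzi
  · exact hS1 (mem_biUnion.2 ⟨z, hzS, mem_starBall.2 hzw⟩)
  · by_cases hwS : w ∈ S
    · exact hS2 ((mem_starHullFinset hd).2 (subset_starHull S (mem_coe.2 hwS)))
    · by_cases hzw' : z = w
      · exact hS2 ((mem_starHullFinset hd).2 ((mem_starInt hd).1 (hzw' ▸ hzi)).2)
      · have hwi := mem_starInt_of_reflTransGen hd hzi (ReflTransGen.single ⟨zdStar_adj.2 ⟨hzw', hzw⟩,
          fun h' => ((mem_starInt hd).1 hzi).1 (mem_coe.1 h'), fun h' => hwS (mem_coe.1 h')⟩)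
        exact hS2 ((mem_starHullFinset hd).2 ((mem_starInt hd).1 hwi).2)

/-- **The hull of an external contour of a volume configuration lies in the inner volume** (and its
interior in the core). [cite: FriedliVelenik2017, §7.3] -/
theorem hull_subset_inner1 (hd : 2 ≤ d) {V : Finset (Site d)} (hV : StarConn (V : Set (Site d))ᶜ) {ω : Finset (Sym2 (Site d))}
    {hω : ω ⊆ freeEdges V} {γ : (rcSetup d).Γ} (h : γ ∈ extContours σ hω) :
    (rcSetup d).hull γ ⊆ inner1 V ∧ (rcSetup d).intr γ ⊆ core V := by
  have hin : (rcSetup d).InVol γ V := inVol_of_mem_extContours h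
  have hhull : (rcSetup d).hull γ ⊆ V := hull_subset_of_inVol hd hV hin
  have hint : (rcSetup d).intr γ ⊆ core V := starInt_subset_core hd hin hhull
  refine ⟨fun x hx => ?_, hint⟩
  rcases (mem_hull_iff hd (S := rcSetup d)).1 hx with hxs | hxi
  · exact thick_subset_inner1 hω ((support_props (supp_mem_of_mem_extContours h).1).1 hxs)
  · exact core_subset_inner1 V (hint hxi)

end External

end RCC

end Literature.Probability.LatticeModels

end
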